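import Summits.KontsevichZagierPeriods.KontsevichZagierPeriods.Theorems.K2SymbolChainsJensenMoveOutside
import Summits.KontsevichZagierPeriods.KontsevichZagierPeriods.Theorems.K2SymbolChainsGenericDifferentiability

/-!
# `JensenIsScissors` (stmt-KontsevichZagierPeriods-5204, route K2SymbolChains) — proof

`JensenIsScissors` — JENSEN IS SCISSORS, the sharper form of the crux `JensenMove`
(stmt-KontsevichZagierPeriods-5199): over any `ℚ`-semialgebraic base `τ ⊆ ℝⁿ` with semialgebraic
weight `h` and centre `α = α₁ + iα₂` on `τ` (weight integrable against `1 + |log|α|²|`), the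
unfolded torus representation `r` of `∫_τ h · J(α)`, `J(α) = ∫₀^{2π} log|e^{iφ} − α| dφ`, and the
unfolded representation `r′` of `∫_τ h · 2π log⁺|α|` satisfy
`[r] − [r′] ∈ AddSubgroup.closure ((1a) ∪ (1b) ∪ (2))` — the subgroup of `KZ.FormalRep` generated
by domain additivity, integrand additivity and semialgebraic changes of variables ALONE: Jensen's
formula is scissors-and-dilation, no Newton–Leibniz / Stokes move is used.

Proof (the crux-strategist's sorry-free line `Cruxes/JensenMove/Lines/jensen_move_complete.lean`,
glue part, re-homed under `Theorems/` by lead c10 of crux stmt-KontsevichZagierPeriods-9129,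
banking; statement and proof verbatim): every piece of the chain was proved for an ARBITRARY
subgroup `S ⊇ (1a) ∪ (1b) ∪ (2)` — `JensenMoveDiscProof.jensenMoveDisc_mem`
(`Theorems/K2SymbolChainsJensenMoveDisc.lean`), `JensenMoveOutsideProof.jensenMoveOutside_mem`
(`Theorems/K2SymbolChainsJensenMoveOutside.lean`) and the `S`-free
`GenericDifferentiabilityProof.genericDifferentiability`
(`Theorems/K2SymbolChainsGenericDifferentiability.lean`) — and `jensenMove_mem` below is the
glue for such an `S` (the body of the landed `jensenMoveGlue_proof` with `KZ.relations` replaced by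
`S`): intersect the smooth loci of `α₁, α₂`, discard the null remainder of the base (cylinders over
null sets are null, rule 1a) and the locus `α = 0` (there `|e(s) − α|² = 1`, empty fibre), cut the
rest of the base into the regimes `0 < |α| ≤ 1` / `|α| > 1` (rule 1a), apply the two pieces, and
note that `r′` lives over the exterior regime up to a null set. The item is the case
`S = AddSubgroup.closure ((1a) ∪ (1b) ∪ (2))` (`AddSubgroup.subset_closure`); the case
`S = KZ.relations` is the crux again. No new definitions.
[Jensen 1899; Kontsevich–Zagier 2001, §1.2, rules 1)–2); Bochnak–Coste–Roy 1998, §§2.2, 2.8, 2.9]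
[folklore]
-/

noncomputable section

open MeasureTheory Set
open Literature.NumberTheory.Transcendental Literature.ModelTheory.ExponentialFields

namespace Summit.KontsevichZagierPeriods.K2SymbolChains

namespace JensenIsScissorsProof

open Literature.NumberTheory.Transcendental.KZ
open Summit.KontsevichZagierPeriods.K2SymbolChains.JensenMoveSplitGlue
open Summit.KontsevichZagierPeriods.K2SymbolChains.JensenMoveDiscProof
open Summit.KontsevichZagierPeriods.K2SymbolChains.JensenMoveOutsideProof
open Summit.KontsevichZagierPeriods.K2SymbolChains.GenericDifferentiabilityProof

/-- **JENSEN IS A MOVE inside any subgroup `S ⊇ (1a) ∪ (1b) ∪ (2)`** — the glue of the split of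
the crux `K2SymbolChains.JensenMove` (stmt-KontsevichZagierPeriods-5199) for an arbitrary such `S`,
assembled from the landed `jensenMoveDisc_mem`, `jensenMoveOutside_mem`, `genericDifferentiability`:
intersect the smooth loci of `α₁, α₂`, discard the null remainder of the base and the locus
`α = 0` (empty fibre), cut the rest into the regimes `0 < |α| ≤ 1` / `|α| > 1` (rule 1a), apply
the two pieces, and note that `r′` lives over the exterior regime up to a null set.
[Jensen 1899; Kontsevich–Zagier 2001, §1.2, rules 1)–2)] [folklore] -/
theorem jensenMove_mem {S : AddSubgroup Literature.NumberTheory.Transcendental.KZ.FormalRep} (hS : Literature.NumberTheory.Transcendental.KZ.domainAddRel ∪ Literature.NumberTheory.Transcendental.KZ.integrandAddRel ∪ Literature.NumberTheory.Transcendental.KZ.changeOfVariablesRel ⊆ S) :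
    ∀ (n : ℕ) (τ : Set (Fin n → ℝ)) (h α₁ α₂ : (Fin n → ℝ) → ℝ) (r r' : Literature.NumberTheory.Transcendental.KZ.IntegralRep (n + 2)), Literature.ModelTheory.ExponentialFields.IsSemialgebraic ℚ τ → Literature.NumberTheory.Transcendental.IsSemialgebraicFunOn ℚ τ h → Literature.NumberTheory.Transcendental.IsSemialgebraicFunOn ℚ τ α₁ → Literature.NumberTheory.Transcendental.IsSemialgebraicFunOn ℚ τ α₂ → MeasureTheory.IntegrableOn (fun x => h x * (1 + |Real.log (α₁ x ^ 2 + α₂ x ^ 2)|)) τ → r.domain = {w | (fun i : Fin n => w (Fin.castAdd 2 i)) ∈ τ ∧ ((1 < w (Fin.natAdd n 1) ∧ w (Fin.natAdd n 1) < (((1 - w (Fin.natAdd n 0) ^ 2) / (1 + w (Fin.natAdd n 0) ^ 2) - α₁ (fun i : Fin n => w (Fin.castAdd 2 i))) ^ 2 + (2 * w (Fin.natAdd n 0) / (1 + w (Fin.natAdd n 0) ^ 2) - α₂ (fun i : Fin n => w (Fin.castAdd 2 i))) ^ 2)) ∨ ((((1 - w (Fin.natAdd n 0) ^ 2) / (1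 + w (Fin.natAdd n 0) ^ 2) - α₁ (fun i : Fin n => w (Fin.castAdd 2 i))) ^ 2 + (2 * w (Fin.natAdd n 0) / (1 + w (Fin.natAdd n 0) ^ 2) - α₂ (fun i : Fin n => w (Fin.castAdd 2 i))) ^ 2) < w (Fin.natAdd n 1) ∧ w (Fin.natAdd n 1) < 1))} → (∀ w ∈ r.domain, r.integrand w = (if 1 < w (Fin.natAdd n 1) then (1:ℝ) else -1) * h (fun i : Fin n => w (Fin.castAdd 2 i)) / ((1 + w (Fin.natAdd n 0) ^ 2) * w (Fin.natAdd n 1))) → r'.domain = {w | (fun i : Fin n => w (Fin.castAdd 2 i)) ∈ τ ∧ 1 < w (Fin.natAdd n 1) ∧ w (Fin.natAdd n 1) < α₁ (fun i : Fin n => w (Fin.castAdd 2 i)) ^ 2 + α₂ (fun i : Fin n => w (Fin.castAdd 2 i)) ^ 2} → (∀ w ∈ r'.domain, r'.integrand w = h (fun i : Fin n => w (Fin.castAdd 2 i)) / ((1 + w (Fin.natAdd n 0) ^ 2) * w (Fin.natAdd n 1))) → Literature.NumberTheory.Transcendental.KZ.of r - Literature.NumberTheory.Transcendental.KZ.of r'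 ∈ S := by
  have hDisc := jensenMoveDisc_mem hS
  have hOut := jensenMoveOutside_mem hS
  have hGen := genericDifferentiability
  intro n τ h α₁ α₂ r r' hτ hh hα₁ hα₂ hint hrd hri hr'd hr'i
  -- Step 1: the common smooth locus `B` of `α₁`, `α₂`, of full measure in `τ`.
  obtain ⟨B₁, hB₁τ, hB₁, hB₁0, hd₁⟩ := hGen n τ α₁ hτ hα₁
  obtain ⟨B₂, hB₂τ, hB₂, hB₂0, hd₂⟩ := hGen n τ α₂ hτ hα₂
  set B : Set (Fin n → ℝ) := B₁ ∩ B₂ with hB_def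
  have hB : IsSemialgebraic ℚ B := hB₁.inter hB₂
  have hBτ : B ⊆ τ := fun x hx => hB₁τ hx.1
  have hτB0 : volume (τ \ B) = 0 := by
    refine measure_mono_null (fun x hx => ?_) (measure_union_null hB₁0 hB₂0)
    rcases hx with ⟨hxτ, hxB⟩
    by_cases h1 : x ∈ B₁
    · exact Or.inr ⟨hxτ, fun h2 => hxB ⟨h1, h2⟩⟩
    · exact Or.inl ⟨hxτ, h1⟩
  -- Step 2: the regimes `|α| > 1` (`Bo`) and `0 < |α| ≤ 1` (`Bd`) inside `B`.
  set ρ2 : (Fin n → ℝ) → ℝ := fun x => α₁ x ^ 2 + α₂ x ^ 2 with hρ2_def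
  have hρ2 : IsSemialgebraicFunOn ℚ B ρ2 :=
    (IsSemialgebraicFunOn.add_holds (IsSemialgebraicFunOn.mul_holds (hα₁.mono hBτ hB) (hα₁.mono hBτ hB))
      (IsSemialgebraicFunOn.mul_holds (hα₂.mono hBτ hB) (hα₂.mono hBτ hB))).congr fun x _ => by
      simp only [hρ2_def, Pi.add_apply, Pi.mul_apply]; ring
  set g : (Fin n → ℝ) → ℝ := fun x => 1 - ρ2 x with hg_def
  have hg : IsSemialgebraicFunOn ℚ B g :=
    (IsSemialgebraicFunOn.sub_holds (isSemialgebraicFunOn_ratCast hB 1) hρ2).congr fun x _ => by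
      simp [hg_def]
  set Bo : Set (Fin n → ℝ) := {x | x ∈ B ∧ g x < 0} with hBo_def
  have hBo : IsSemialgebraic ℚ Bo := hg.isSemialgebraic_sep_neg
  set Bc : Set (Fin n → ℝ) := {x | x ∈ B ∧ 0 ≤ g x} with hBc_def
  have hBc : IsSemialgebraic ℚ Bc := hg.isSemialgebraic_sep_nonneg
  have hBcB : Bc ⊆ B := fun x hx => hx.1
  set Bd : Set (Fin n → ℝ) := {x | x ∈ Bc ∧ ρ2 x ≠ 0} with hBd_def
  have hBd : IsSemialgebraic ℚ Bd := (hρ2.mono hBcB hBc).isSemialgebraic_sep_ne_zero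
  have hBoB : Bo ⊆ B := fun x hx => hx.1
  have hBdB : Bd ⊆ B := fun x hx => hx.1.1
  have hBoτ : Bo ⊆ τ := hBoB.trans hBτ
  have hBdτ : Bd ⊆ τ := hBdB.trans hBτ
  have hρ2_nonneg : ∀ x, 0 ≤ ρ2 x := fun x => by simp only [hρ2_def]; positivity
  have hBo_regime : ∀ x ∈ Bo, 1 < α₁ x ^ 2 + α₂ x ^ 2 := fun x hx => by
    have := hx.2; simp only [hg_def, hρ2_def] at this; linarith
  have hBd_regime : ∀ x ∈ Bd, 0 < α₁ x ^ 2 + α₂ x ^ 2 ∧ α₁ x ^ 2 + α₂ x ^ 2 ≤ 1 := fun x hx => by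
    have h1 := hx.1.2; have h2 := hx.2
    simp only [hg_def, hρ2_def] at h1 h2
    exact ⟨(hρ2_nonneg x).lt_of_ne (Ne.symm h2), by linarith⟩
  have hdiffB : ∀ x ∈ B, DifferentiableAt ℝ α₁ x ∧ DifferentiableAt ℝ α₂ x :=
    fun x hx => ⟨hd₁ x hx.1, hd₂ x hx.2⟩
  -- the trichotomy on the base: outside `Bd ∪ Bo`, a point of `τ` is off `B` or has `α = 0`
  have htrich : ∀ x ∈ τ, x ∉ Bd → x ∉ Bo → x ∉ B ∨ (α₁ x = 0 ∧ α₂ x = 0) := by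
    intro x _ hxd hxo
    by_cases hxB : x ∈ B
    · right
      have hg0 : 0 ≤ g x := not_lt.1 fun hlt => hxo ⟨hxB, hlt⟩
      have hρ0 : ρ2 x = 0 := by
        by_contra hne
        exact hxd ⟨⟨hxB, hg0⟩, hne⟩
      simp only [hρ2_def] at hρ0
      have h1 : α₁ x ^ 2 = 0 := by nlinarith [sq_nonneg (α₁ x), sq_nonneg (α₂ x)]
      have h2 : α₂ x ^ 2 = 0 := by nlinarith [sq_nonneg (α₁ x), sq_nonneg (α₂ x)]
      exact ⟨pow_eq_zero_iff (n := 2) (by norm_num) |>.1 h1, pow_eq_zero_iff (n := 2) (by norm_num) |>.1 h2⟩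
    · exact Or.inl hxB
  -- Step 3: cut `r` along the cylinders over `Bd` and `Bo`.
  set Cd : Set (Fin (n + 2) → ℝ) := {w | (fun i : Fin n => w (Fin.castAdd 2 i)) ∈ Bd} with hCd_def
  set Co : Set (Fin (n + 2) → ℝ) := {w | (fun i : Fin n => w (Fin.castAdd 2 i)) ∈ Bo} with hCo_def
  have hCd : IsSemialgebraic ℚ Cd := isSemialgebraic_cyl2 hBd
  have hCo : IsSemialgebraic ℚ Co := isSemialgebraic_cyl2 hBo
  set rd := r.restrict (r.domain ∩ Cd) (r.isSemialgebraic_domain.inter hCd) inter_subset_left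
    with hrd_def
  set r₁ := r.restrict (r.domain \ Cd) (r.isSemialgebraic_domain.diff hCd) sdiff_subset
    with hr₁_def
  have e1 : of r - of rd - of r₁ ∈ S :=
    of_sub_restrict_inter_sub_restrict_diff_mem hS r hCd
  set ro := r₁.restrict (r₁.domain ∩ Co) (r₁.isSemialgebraic_domain.inter hCo) inter_subset_left
    with hro_def
  set r₂ := r₁.restrict (r₁.domain \ Co) (r₁.isSemialgebraic_domain.diff hCo) sdiff_subset
    with hr₂_def
  have e2 : of r₁ - of ro - of r₂ ∈ S :=
    of_sub_restrict_inter_sub_restrict_diff_mem hS r₁ hCo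
  -- Step 4: the remainder `r₂` lives over `(τ ∖ B) ∪ {α = 0}`; over `{α = 0}` its fibre is empty.
  have e3 : of r₂ ∈ S := by
    refine of_mem_of_volume_eq_zero hS r₂ (measure_mono_null (fun w hw => ?_) (volume_cyl2_eq_zero hτB0))
    have hw : w ∈ (r.domain \ Cd) \ Co := hw
    rcases hw with ⟨⟨hwr, hwd⟩, hwo⟩
    rw [hrd] at hwr
    rcases hwr with ⟨hxτ, hfib⟩
    rcases htrich _ hxτ hwd hwo with hxB | ⟨h10, h20⟩
    · exact ⟨hxτ, hxB⟩
    · exfalso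
      rw [h10, h20, ratCircle_normSq] at hfib
      rcases hfib with ⟨h1, h2⟩ | ⟨h1, h2⟩ <;> linarith
  -- Step 5: piece 1 on the punctured-disc regime.
  have e4 : of rd ∈ S := by
    refine hDisc n Bd h α₁ α₂ rd hBd (hh.mono hBdτ hBd) (hα₁.mono hBdτ hBd) (hα₂.mono hBdτ hBd)
      (fun x hx => hdiffB x (hBdB hx)) hBd_regime (hint.mono_set hBdτ) ?_ ?_
    · show r.domain ∩ Cd = _
      ext w
      rw [hrd]
      simp only [mem_inter_iff, mem_setOf_eq, hCd_def]
      constructor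
      · rintro ⟨⟨-, hf⟩, hx⟩; exact ⟨hx, hf⟩
      · rintro ⟨hx, hf⟩; exact ⟨⟨hBdτ hx, hf⟩, hx⟩
    · intro w hw
      exact hri w hw.1
  -- Step 6: piece 2 on the exterior regime, with the matching piece of `r′`.
  set r'o := r'.restrict (r'.domain ∩ Co) (r'.isSemialgebraic_domain.inter hCo) inter_subset_left
    with hr'o_def
  have e5 : of ro - of r'o ∈ S := by
    refine hOut n Bo h α₁ α₂ ro r'o hBo (hh.mono hBoτ hBo) (hα₁.mono hBoτ hBo) (hα₂.mono hBoτ hBo)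
      (fun x hx => hdiffB x (hBoB hx)) hBo_regime (hint.mono_set hBoτ) ?_ ?_ ?_ ?_
    · show (r.domain \ Cd) ∩ Co = _
      ext w
      rw [hrd]
      simp only [mem_inter_iff, mem_sdiff, mem_setOf_eq, hCd_def, hCo_def]
      constructor
      · rintro ⟨⟨⟨-, hf⟩, -⟩, hx⟩; exact ⟨hx, hf⟩
      · rintro ⟨hx, hf⟩
        refine ⟨⟨⟨hBoτ hx, hf⟩, fun hxd => ?_⟩, hx⟩
        have h1 := hxd.1.2; have h2 := hx.2
        exact absurd h2 (not_lt.2 h1)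
    · intro w hw
      exact hri w hw.1.1
    · show r'.domain ∩ Co = _
      ext w
      rw [hr'd]
      simp only [mem_inter_iff, mem_setOf_eq, hCo_def]
      constructor
      · rintro ⟨⟨-, hf⟩, hx⟩; exact ⟨hx, hf⟩
      · rintro ⟨hx, hf⟩; exact ⟨⟨hBoτ hx, hf⟩, hx⟩
    · intro w hw
      exact hr'i w hw.1
  -- Step 7: `r′` minus its exterior piece lives over `τ ∖ B` (its fibres over `|α| ≤ 1` are empty).
  have e6 : of r' - of r'o ∈ S := by
    refine of_sub_of_mem_of_subset hS inter_subset_left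
      (measure_mono_null (fun w hw => ?_) (volume_cyl2_eq_zero hτB0)) (fun _ _ => rfl)
    have hw : w ∈ r'.domain \ (r'.domain ∩ Co) := hw
    rcases hw with ⟨hwr, hwo⟩
    have hwo' : w ∉ Co := fun h' => hwo ⟨hwr, h'⟩
    rw [hr'd] at hwr
    rcases hwr with ⟨hxτ, h1, h2⟩
    refine ⟨hxτ, fun hxB => hwo' ⟨hxB, ?_⟩⟩
    show g _ < 0
    simp only [hg_def, hρ2_def]
    linarith
  -- Step 8: sum up.
  have : of r - of r' = (of r - of rd - of r₁) + (of r₁ - of ro - of r₂) + of r₂ + of rd +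
      (of ro - of r'o) - (of r' - of r'o) := by abel
  rw [this]
  exact S.sub_mem (S.add_mem (S.add_mem (S.add_mem
    (S.add_mem e1 e2) e3) e4) e5) e6

end JensenIsScissorsProof

open JensenIsScissorsProof in
/-- **JENSEN IS SCISSORS** — the support item `K2SymbolChains.JensenIsScissors`
(stmt-KontsevichZagierPeriods-5204): the whole Jensen chain `[r] − [r′]` lies in the
Newton–Leibniz-free sub-calculus `AddSubgroup.closure ((1a) ∪ (1b) ∪ (2))` of `KZ.FormalRep`.
Proof: `jensenMove_mem` for `S` = that closure (`AddSubgroup.subset_closure`). [Jensen 1899;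
Kontsevich–Zagier 2001, §1.2, rules 1)–2)] [folklore] -/
theorem jensenIsScissors_proof :
    Summit.KontsevichZagierPeriods.KontsevichZagierPeriods.Theses.K2SymbolChains.JensenIsScissors :=
  jensenMove_mem AddSubgroup.subset_closure

end Summit.KontsevichZagierPeriods.K2SymbolChains
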